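import Summits.Parity.GeneralizedHardyLittlewood.Theorems.PrimeLevelFamEdgeMomentsBeyondDiagonalFirstOrderAFE
import Literature.NumberTheory.LFunctions.Bettin2017FirstMomentPrimeLevel
import HarnessLib

/-!
# The UNBALANCED order-`k` approximate functional equation and its harmonic average at prime level
# (helper for crux K_A `PrimeLevelFamEdge.MomentsBeyondDiagonal`, stmt-Parity-20007, stub `stub_first : SubFirst` ∀`Q`)

Bettin's device for the twisted first moment beyond the diagonal (Bettin 2017, §2: split the axis integral at an
UNBALANCED height `y`, so that the dual piece starts at `1/(Ny)` and is exponentially small) run at every order `k`: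
* §1 `derivLambda_eq_unbalanced`: for a Fricke eigenform `w_N f = ηf`, `η² = 1`, every `k` and every `y > 0`,
  `Λ^{(k)}(f,½) = 2π q̂^{1/2} [∫_y^∞ f(iv)(log √N v)^k dv + (−1)^k(−η) ∫_{1/(Ny)}^∞ f(iv)(log √N v)^k dv]`
  (`derivLambda_eq_integral` + the Fricke flip `IsFrickeEigen.integral_imagAxis_Ioi_inv_mul_logPow`);
* §2 `integral_exp_mul_logPow_parts`: the scalar integration by parts
  `c∫_y^∞ e^{−ct}(log √N t)^k dt = e^{−cy}(log √N y)^k + ∫_y^∞ e^{−ct}·k(log √N t)^{k−1}t⁻¹ dt` (`c ≥ 2π`), which turns the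
  log-weight into an integral over HEIGHTS of Bettin's damped weights `n^{−1/2}e^{−2πnt}`;
* §3 the harmonic averages against `λ_f(m)` and `ε_f λ_f(m)` through the `n`-series, at the level of the Petersson
  pair average `pet N m n = Σʰ λ_f(m)λ_f(n)` (`hasSum_harmonicSum_heckeLambda_mul_axisIntegral`,
  `hasSum_harmonicSum_fricke_mul_axisIntegral`, `N` prime for the latter: `ε_f a_f(n) = −a_f(Nn)`);
* §4 `harmonicSum_heckeLambda_mul_derivLambda_eq`: for `N` prime, every `m`, `k`, `y > 0`,
  `Σʰ λ_f(m)Λ^{(k)}(f,½) = 2π q̂^{1/2} [Σ_n √n·pet(m,n)·I_k(n,y) + (−1)^k Σ_n √(Nn)·pet(m,Nn)·I_k(n,1/(Ny))]`,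
  `I_k(n,a) = ∫_a^∞ e^{−2πnv}(log √N v)^k dv`.
Proof only; no definition; nothing about Landau–Siegel zeros; K_A NOT proved.
-/

noncomputable section

open scoped Real
open Complex Set MeasureTheory Filter Topology CongruenceSubgroup
open Literature.NumberTheory.EllipticCurves.ModularForms
open Literature.NumberTheory.LFunctions Literature.NumberTheory.LFunctions.KMV2000

namespace Summit.Parity.GeneralizedHardyLittlewood.Theorems.MomentsBeyondDiagonal.FirstOrderAFE

variable {N : ℕ} [NeZero N]

/-! ## §1. The unbalanced Fricke split at order `k` -/

/-- **Unbalanced order-`k` AFE.** For `w_N f = ηf`, `η² = 1`, every `k` and every height `y > 0`: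
`Λ^{(k)}(f,½) = 2π q̂^{1/2} [∫_y^∞ f(iv)(log √N v)^k dv + (−1)^k (−η) ∫_{1/(Ny)}^∞ f(iv)(log √N v)^k dv]`.
[cite: Bettin2017, Lemma 2.1 and §2 (2.1)–(2.2)] [cite: KowalskiMichelVanderKam2000, (13) p. 9] -/
theorem derivLambda_eq_unbalanced (f : CuspForm (Gamma0 N) 2) (k : ℕ) {η : ℂ}
    (hW : IsFrickeEigen N f η) (hη : η ^ 2 = 1) {y : ℝ} (hy : 0 < y) :
    derivLambda N k f = 2 * (π : ℂ) * ((qhat N : ℝ) : ℂ) ^ (1 / 2 : ℂ) *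
      ((∫ v in Ioi y, f (UpperHalfPlane.ofComplex (Complex.I * v)) *
          (((Real.log (Real.sqrt N * v)) ^ k : ℝ) : ℂ)) +
        (-1 : ℂ) ^ k * (-η) * ∫ v in Ioi (((N : ℝ) * y)⁻¹),
          f (UpperHalfPlane.ofComplex (Complex.I * v)) * (((Real.log (Real.sqrt N * v)) ^ k : ℝ) : ℂ)) := by
  set G : ℝ → ℂ := fun v ↦ f (UpperHalfPlane.ofComplex (Complex.I * v)) *
    (((Real.log (Real.sqrt N * v)) ^ k : ℝ) : ℂ) with hG
  have hint : IntegrableOn G (Ioi 0) := integrableOn_imagAxis_mul_logPow f k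
  have hsplit : ∫ t in Ioi (0 : ℝ), G t = (∫ t in Ioc 0 y, G t) + ∫ t in Ioi y, G t := by
    have h := intervalIntegral.integral_Ioi_sub_Ioi hint hy.le
    rw [intervalIntegral.integral_of_le hy.le] at h
    linear_combination h
  have hflip : ∫ t in Ioi (((N : ℝ) * y)⁻¹), G t = (-1) ^ k * (-η) * ∫ t in Ioc (0 : ℝ) y, G t :=
    hW.integral_imagAxis_Ioi_inv_mul_logPow k hy
  have hu : ((-1 : ℂ) ^ k) ^ 2 = 1 := by
    rw [← pow_mul, show k * 2 = 2 * k by ring, pow_mul]; norm_num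
  rw [derivLambda_eq_integral f k]
  show _ * ∫ t in Ioi (0 : ℝ), G t =
    _ * ((∫ t in Ioi y, G t) + (-1 : ℂ) ^ k * (-η) * ∫ t in Ioi (((N : ℝ) * y)⁻¹), G t)
  congr 1
  set H : ℂ := ∫ t in Ioc (0 : ℝ) y, G t
  linear_combination hsplit - ((-1 : ℂ) ^ k * (-η)) * hflip - H * η ^ 2 * hu - H * hη

/-! ## §2. The scalar integration by parts -/

omit [NeZero N] in
/-- `d/dt (log √N t)^k = k (log √N t)^{k−1} t⁻¹` for `t > 0` (`N ≥ 1`). -/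
theorem hasDerivAt_logPow (hN : 0 < N) (k : ℕ) {t : ℝ} (ht : 0 < t) :
    HasDerivAt (fun v : ℝ ↦ (Real.log (Real.sqrt N * v)) ^ k)
      ((k : ℝ) * (Real.log (Real.sqrt N * t)) ^ (k - 1) * t⁻¹) t := by
  have hs : 0 < Real.sqrt N := Real.sqrt_pos.mpr (by exact_mod_cast hN)
  have h1 : HasDerivAt (fun v : ℝ ↦ Real.sqrt N * v) (Real.sqrt N * 1) t :=
    (hasDerivAt_id t).const_mul (Real.sqrt N)
  have h2 : HasDerivAt (fun v : ℝ ↦ Real.log (Real.sqrt N * v))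
      ((Real.sqrt N * t)⁻¹ * (Real.sqrt N * 1)) t :=
    (Real.hasDerivAt_log (mul_pos hs ht).ne').comp t h1
  have h3 := h2.pow k
  refine h3.congr_deriv ?_
  have hs' : Real.sqrt N ≠ 0 := hs.ne'
  have ht' : t ≠ 0 := ht.ne'
  field_simp

/-- `(log √N t)^k e^{−ct} → 0` as `t → ∞` (`c > 0`). -/
theorem tendsto_logPow_mul_exp_atTop (k : ℕ) {c : ℝ} (hc : 0 < c) :
    Tendsto (fun t : ℝ ↦ (Real.log (Real.sqrt N * t)) ^ k * Real.exp (-(c * t))) atTop (𝓝 0) := by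
  have hs : 0 < Real.sqrt N := Real.sqrt_pos.mpr (by exact_mod_cast NeZero.pos N)
  -- `|log(√N t)|^k ≤ (√N t)^k` for `√N t ≥ 1`, and `(√N t)^k e^{-ct} = (√N/c)^k (ct)^k e^{-ct} → 0`
  have h1 : Tendsto (fun t : ℝ ↦ (c * t) ^ k * Real.exp (-(c * t))) atTop (𝓝 0) :=
    (Real.tendsto_pow_mul_exp_neg_atTop_nhds_zero k).comp (tendsto_id.const_mul_atTop hc)
  have h2 : Tendsto (fun t : ℝ ↦ (Real.sqrt N / c) ^ k * ((c * t) ^ k * Real.exp (-(c * t)))) atTop (𝓝 0) := by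
    simpa using h1.const_mul ((Real.sqrt N / c) ^ k)
  refine squeeze_zero_norm' ?_ h2
  filter_upwards [eventually_ge_atTop (Real.sqrt N)⁻¹] with t ht
  have ht0 : 0 < t := lt_of_lt_of_le (inv_pos.mpr hs) ht
  have hNt : 1 ≤ Real.sqrt N * t := by
    rw [← mul_inv_cancel₀ hs.ne']; exact mul_le_mul_of_nonneg_left ht hs.le
  have hlog0 : 0 ≤ Real.log (Real.sqrt N * t) := Real.log_nonneg hNt
  have hlog1 : Real.log (Real.sqrt N * t) ≤ Real.sqrt N * t :=
    (Real.log_le_sub_one_of_pos (by linarith)).trans (by linarith)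
  rw [norm_mul, norm_pow, Real.norm_of_nonneg hlog0, Real.norm_of_nonneg (Real.exp_pos _).le]
  have hct : (Real.sqrt N / c) ^ k * (c * t) ^ k = (Real.sqrt N * t) ^ k := by
    rw [← mul_pow]; congr 1; field_simp
  rw [← mul_assoc, hct]
  exact mul_le_mul_of_nonneg_right (pow_le_pow_left₀ hlog0 hlog1 k) (Real.exp_pos _).le

/-- `e^{−2πt}|log √N t|^j` is integrable on `(y, ∞)`, `y ≥ 0` (tree: `integrableOn_exp_neg_two_pi_mul_abs_log_pow`). -/
theorem integrableOn_exp_abs_logPow_Ioi (j : ℕ) {y : ℝ} (hy : 0 ≤ y) :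
    IntegrableOn (fun v : ℝ ↦ Real.exp (-(2 * π * v)) * |Real.log (Real.sqrt N * v)| ^ j) (Ioi y) :=
  (integrableOn_exp_neg_two_pi_mul_abs_log_pow (N := N) j).mono_set (Ioi_subset_Ioi hy)

/-- **Integration by parts for the log weight**: for `c ≥ 2π`, `y > 0` and every `k`,
`c ∫_y^∞ e^{−ct}(log √N t)^k dt = e^{−cy}(log √N y)^k + ∫_y^∞ e^{−ct} · k (log √N t)^{k−1} t⁻¹ dt`.
[cite: Bettin2017, §2 (2.1)–(2.3)] -/
theorem integral_exp_mul_logPow_parts {c : ℝ} (hc : 2 * π ≤ c) (k : ℕ) {y : ℝ} (hy : 0 < y) :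
    c * ∫ t in Ioi y, Real.exp (-(c * t)) * (Real.log (Real.sqrt N * t)) ^ k =
      Real.exp (-(c * y)) * (Real.log (Real.sqrt N * y)) ^ k +
        ∫ t in Ioi y, Real.exp (-(c * t)) * ((k : ℝ) * (Real.log (Real.sqrt N * t)) ^ (k - 1) * t⁻¹) := by
  have hN : 0 < N := NeZero.pos N
  have hs : 0 < Real.sqrt N := Real.sqrt_pos.mpr (by exact_mod_cast hN)
  have hc0 : 0 < c := lt_of_lt_of_le Real.two_pi_pos hc
  set u : ℝ → ℝ := fun t ↦ (Real.log (Real.sqrt N * t)) ^ k with hu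
  set u' : ℝ → ℝ := fun t ↦ (k : ℝ) * (Real.log (Real.sqrt N * t)) ^ (k - 1) * t⁻¹ with hu'
  set v : ℝ → ℝ := fun t ↦ Real.exp (-(c * t)) with hv
  set v' : ℝ → ℝ := fun t ↦ -c * Real.exp (-(c * t)) with hv'
  have hu_d : ∀ t ∈ Ioi y, HasDerivAt u (u' t) t := fun t ht ↦ hasDerivAt_logPow hN k (hy.trans ht)
  have hv_d : ∀ t ∈ Ioi y, HasDerivAt v (v' t) t := by
    intro t _
    have h : HasDerivAt (fun s : ℝ ↦ -(c * s)) (-(c * 1)) t := ((hasDerivAt_id t).const_mul c).neg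
    have h2 := (Real.hasDerivAt_exp (-(c * t))).comp t h
    have h3 : HasDerivAt v (Real.exp (-(c * t)) * -(c * 1)) t := h2
    exact h3.congr_deriv (by simp only [hv']; ring)
  -- continuity on `Ioi y`
  have hlog_cont : ContinuousOn (fun t : ℝ ↦ Real.log (Real.sqrt N * t)) (Ioi y) :=
    Real.continuousOn_log.comp (by fun_prop) fun t ht ↦ (mul_pos hs (hy.trans ht)).ne'
  have hu_cont : ContinuousOn u (Ioi y) := hlog_cont.pow k
  have hu'_cont : ContinuousOn u' (Ioi y) :=
    (continuousOn_const.mul (hlog_cont.pow (k - 1))).mul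
      (continuousOn_inv₀.mono fun t ht ↦ (hy.trans ht).ne')
  have hv_cont : ContinuousOn v (Ioi y) := by rw [hv]; fun_prop
  have hv'_cont : ContinuousOn v' (Ioi y) := by rw [hv']; fun_prop
  -- the comparison `e^{-ct} ≤ e^{-2πt}` on `t > 0`
  have hexp : ∀ t ∈ Ioi y, Real.exp (-(c * t)) ≤ Real.exp (-(2 * π * t)) := by
    intro t ht
    have ht0 : 0 < t := hy.trans ht
    exact Real.exp_le_exp.mpr (by nlinarith)
  -- integrability of `u v'` and `u' v`
  have huv' : IntegrableOn (u * v') (Ioi y) := by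
    have hmaj := ((integrableOn_exp_abs_logPow_Ioi (N := N) k hy.le).const_mul c)
    refine Integrable.mono' hmaj ((hu_cont.mul hv'_cont).aestronglyMeasurable measurableSet_Ioi) ?_
    refine (ae_restrict_iff' measurableSet_Ioi).mpr (Filter.Eventually.of_forall fun t ht ↦ ?_)
    simp only [Pi.mul_apply, hu, hv']
    rw [norm_mul, norm_pow, Real.norm_eq_abs, norm_mul, norm_neg, Real.norm_of_nonneg hc0.le,
      Real.norm_of_nonneg (Real.exp_pos _).le]
    calc |Real.log (Real.sqrt N * t)| ^ k * (c * Real.exp (-(c * t)))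
        = c * (Real.exp (-(c * t)) * |Real.log (Real.sqrt N * t)| ^ k) := by ring
      _ ≤ c * (Real.exp (-(2 * π * t)) * |Real.log (Real.sqrt N * t)| ^ k) :=
          mul_le_mul_of_nonneg_left (mul_le_mul_of_nonneg_right (hexp t ht) (by positivity)) hc0.le
  have hu'v : IntegrableOn (u' * v) (Ioi y) := by
    have hmaj := ((integrableOn_exp_abs_logPow_Ioi (N := N) (k - 1) hy.le).const_mul ((k : ℝ) * y⁻¹))
    refine Integrable.mono' hmaj ((hu'_cont.mul hv_cont).aestronglyMeasurable measurableSet_Ioi) ?_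
    refine (ae_restrict_iff' measurableSet_Ioi).mpr (Filter.Eventually.of_forall fun t ht ↦ ?_)
    have ht : y < t := ht
    have ht0 : 0 < t := hy.trans ht
    simp only [Pi.mul_apply, hu', hv]
    rw [norm_mul, norm_mul, norm_mul, norm_pow]
    simp only [Real.norm_eq_abs, Nat.abs_cast, abs_inv, abs_of_pos ht0, Real.abs_exp]
    have hinv : t⁻¹ ≤ y⁻¹ := inv_anti₀ hy ht.le
    calc (k : ℝ) * |Real.log (Real.sqrt N * t)| ^ (k - 1) * t⁻¹ * Real.exp (-(c * t))
        ≤ (k : ℝ) * |Real.log (Real.sqrt N * t)| ^ (k - 1) * y⁻¹ * Real.exp (-(2 * π * t)) := by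
          have := hexp t ht
          gcongr
      _ = (k : ℝ) * y⁻¹ * (Real.exp (-(2 * π * t)) * |Real.log (Real.sqrt N * t)| ^ (k - 1)) := by ring
  -- boundary values
  have h_zero : Tendsto (u * v) (𝓝[>] y) (𝓝 (u y * v y)) := by
    have hcont : ContinuousAt (u * v) y := by
      have hy' : Real.sqrt N * y ≠ 0 := (mul_pos hs hy).ne'
      show ContinuousAt (fun t ↦ u t * v t) y
      simp only [hu, hv]
      exact (((Real.continuousAt_log hy').comp (by fun_prop)).pow k).mul (by fun_prop)
    exact hcont.tendsto.mono_left nhdsWithin_le_nhds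
  have h_infty : Tendsto (u * v) atTop (𝓝 0) := tendsto_logPow_mul_exp_atTop (N := N) k hc0
  have hparts := integral_Ioi_mul_deriv_eq_deriv_mul hu_d hv_d huv' hu'v h_zero h_infty
  -- `∫ u v' = -c ∫ e^{-ct} u`, `∫ u' v = ∫ e^{-ct} u'`
  have h1 : ∫ t in Ioi y, u t * v' t = -c * ∫ t in Ioi y, Real.exp (-(c * t)) * (Real.log (Real.sqrt N * t)) ^ k := by
    rw [← integral_const_mul]
    refine setIntegral_congr_fun measurableSet_Ioi fun t _ ↦ ?_
    simp only [hu, hv']; ring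
  have h2 : ∫ t in Ioi y, u' t * v t =
      ∫ t in Ioi y, Real.exp (-(c * t)) * ((k : ℝ) * (Real.log (Real.sqrt N * t)) ^ (k - 1) * t⁻¹) := by
    refine setIntegral_congr_fun measurableSet_Ioi fun t _ ↦ ?_
    simp only [hu', hv]; ring
  rw [h1, h2] at hparts
  have huy : u y * v y = Real.exp (-(c * y)) * (Real.log (Real.sqrt N * y)) ^ k := by
    simp only [hu, hv]; ring
  rw [huy] at hparts
  linarith

/-! ## §3. The harmonic averages through the `n`-series -/

omit [NeZero N] in
/-- Weight `2`: `a_f(n) = √n · λ_f(n)` (both sides vanish at `n = 0`). [cite: IwaniecKowalski2004, §14.10] -/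
theorem cuspCoeff_eq_sqrt_mul_heckeLambda (f : CuspForm (Gamma0 N) 2) (n : ℕ) :
    cuspCoeff f n = ((Real.sqrt n : ℝ) : ℂ) * GL2Family.heckeLambda f n := by
  rcases Nat.eq_zero_or_pos n with rfl | hn
  · simp [cuspCoeff_zero one_mem_strictPeriods_Gamma0 f]
  · have hn0 : (0 : ℝ) < n := by exact_mod_cast hn
    rw [Bettin2017.heckeLambda_weight_two, Real.sqrt_eq_rpow, mul_left_comm, ← Complex.ofReal_mul,
      ← Real.rpow_add hn0, show (1 / 2 : ℝ) + -(1 / 2) = 0 by norm_num, Real.rpow_zero, Complex.ofReal_one,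
      mul_one]

/-- **`Σʰ λ_f(m) ∫_a^∞ f(iv)(log √N v)^k dv = Σ_n √n · pet(m,n) · I_k(n,a)`**, `I_k(n,a) = ∫_a^∞ e^{−2πnv}(log √N v)^k dv`
(any level; the finite harmonic average of the termwise-integrated `q`-expansions `hasSum_integral_Ioi_imagAxis_logWeight`,
`Σʰ λ_f(m)a_f(n) = √n Σʰλ_f(m)λ_f(n)`). [cite: Bettin2017, §2 (2.3)] -/
theorem hasSum_harmonicSum_heckeLambda_mul_axisIntegral (m k : ℕ) {a : ℝ} (ha : 0 < a) :
    HasSum (fun n : ℕ ↦ ((Real.sqrt n : ℝ) : ℂ) * KowalskiMichel2000.pet N m n *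
        ((∫ v in Ioi a, Real.exp (-(2 * Real.pi * n) * v) * (Real.log (Real.sqrt N * v)) ^ k : ℝ) : ℂ))
      (GL2Family.harmonicSum N 2 (fun f ↦ GL2Family.heckeLambda f m *
        ∫ v in Ioi a, f (UpperHalfPlane.ofComplex (Complex.I * v)) *
          (((Real.log (Real.sqrt N * v)) ^ k : ℝ) : ℂ))) := by
  have hfin := finite_newforms0_holds N 2
  set I : ℕ → ℂ := fun n ↦
    ((∫ v in Ioi a, Real.exp (-(2 * Real.pi * n) * v) * (Real.log (Real.sqrt N * v)) ^ k : ℝ) : ℂ) with hI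
  have hf1 : ∀ f ∈ hfin.toFinset, HasSum (fun n : ℕ ↦ (GL2Family.harmonicWeight f : ℂ) *
      (GL2Family.heckeLambda f m * (cuspCoeff f n * I n)))
      ((GL2Family.harmonicWeight f : ℂ) * (GL2Family.heckeLambda f m *
        ∫ v in Ioi a, f (UpperHalfPlane.ofComplex (Complex.I * v)) *
          (((Real.log (Real.sqrt N * v)) ^ k : ℝ) : ℂ))) :=
    fun f _ ↦ ((hasSum_integral_Ioi_imagAxis_logWeight f k ha).mul_left _).mul_left _
  have h := hasSum_sum hf1
  have hval : ∑ f ∈ hfin.toFinset, (GL2Family.harmonicWeight f : ℂ) * (GL2Family.heckeLambda f m *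
        ∫ v in Ioi a, f (UpperHalfPlane.ofComplex (Complex.I * v)) *
          (((Real.log (Real.sqrt N * v)) ^ k : ℝ) : ℂ)) =
      GL2Family.harmonicSum N 2 (fun f ↦ GL2Family.heckeLambda f m *
        ∫ v in Ioi a, f (UpperHalfPlane.ofComplex (Complex.I * v)) *
          (((Real.log (Real.sqrt N * v)) ^ k : ℝ) : ℂ)) := by
    rw [GL2Family.harmonicSum, finsum_mem_eq_finite_toFinset_sum _ hfin]
  have hfun : (fun n : ℕ ↦ ∑ f ∈ hfin.toFinset, (GL2Family.harmonicWeight f : ℂ) *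
      (GL2Family.heckeLambda f m * (cuspCoeff f n * I n))) =
      fun n : ℕ ↦ ((Real.sqrt n : ℝ) : ℂ) * KowalskiMichel2000.pet N m n * I n := by
    funext n
    rw [KowalskiMichel2000.pet, GL2Family.harmonicSum, finsum_mem_eq_finite_toFinset_sum _ hfin,
      Finset.mul_sum, Finset.sum_mul]
    refine Finset.sum_congr rfl fun f _ ↦ ?_
    rw [cuspCoeff_eq_sqrt_mul_heckeLambda]
    ring
  rw [hfun, hval] at h
  exact h

/-- **The dual average (`N` prime): `Σʰ ε_f λ_f(m) ∫_a^∞ f(iv)(log √N v)^k dv = −Σ_n √(Nn) · pet(m,Nn) · I_k(n,a)`**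
(`ε_f a_f(n) = −a_f(Nn) = −√(Nn) λ_f(Nn)`, `frickeEigenvalue_mul_cuspCoeff`).
[cite: Bettin2017, §2 (2.3)] [cite: KowalskiMichel2000, §2.4.2 p. 312] -/
theorem hasSum_harmonicSum_fricke_mul_axisIntegral (hN : N.Prime) (m k : ℕ) {a : ℝ} (ha : 0 < a) :
    HasSum (fun n : ℕ ↦ -(((Real.sqrt ((N : ℝ) * n) : ℝ) : ℂ) * KowalskiMichel2000.pet N m (N * n) *
        ((∫ v in Ioi a, Real.exp (-(2 * Real.pi * n) * v) * (Real.log (Real.sqrt N * v)) ^ k : ℝ) : ℂ)))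
      (GL2Family.harmonicSum N 2 (fun f ↦ frickeEigenvalue f * GL2Family.heckeLambda f m *
        ∫ v in Ioi a, f (UpperHalfPlane.ofComplex (Complex.I * v)) *
          (((Real.log (Real.sqrt N * v)) ^ k : ℝ) : ℂ))) := by
  have hfin := finite_newforms0_holds N 2
  set I : ℕ → ℂ := fun n ↦
    ((∫ v in Ioi a, Real.exp (-(2 * Real.pi * n) * v) * (Real.log (Real.sqrt N * v)) ^ k : ℝ) : ℂ) with hI
  have hf1 : ∀ f ∈ hfin.toFinset, HasSum (fun n : ℕ ↦ (GL2Family.harmonicWeight f : ℂ) *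
      (frickeEigenvalue f * GL2Family.heckeLambda f m * (cuspCoeff f n * I n)))
      ((GL2Family.harmonicWeight f : ℂ) * (frickeEigenvalue f * GL2Family.heckeLambda f m *
        ∫ v in Ioi a, f (UpperHalfPlane.ofComplex (Complex.I * v)) *
          (((Real.log (Real.sqrt N * v)) ^ k : ℝ) : ℂ))) :=
    fun f _ ↦ ((hasSum_integral_Ioi_imagAxis_logWeight f k ha).mul_left _).mul_left _
  have h := hasSum_sum hf1
  have hval : ∑ f ∈ hfin.toFinset, (GL2Family.harmonicWeight f : ℂ) *
      (frickeEigenvalue f * GL2Family.heckeLambda f m *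
        ∫ v in Ioi a, f (UpperHalfPlane.ofComplex (Complex.I * v)) *
          (((Real.log (Real.sqrt N * v)) ^ k : ℝ) : ℂ)) =
      GL2Family.harmonicSum N 2 (fun f ↦ frickeEigenvalue f * GL2Family.heckeLambda f m *
        ∫ v in Ioi a, f (UpperHalfPlane.ofComplex (Complex.I * v)) *
          (((Real.log (Real.sqrt N * v)) ^ k : ℝ) : ℂ)) := by
    rw [GL2Family.harmonicSum, finsum_mem_eq_finite_toFinset_sum _ hfin]
  have hfun : (fun n : ℕ ↦ ∑ f ∈ hfin.toFinset, (GL2Family.harmonicWeight f : ℂ) *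
      (frickeEigenvalue f * GL2Family.heckeLambda f m * (cuspCoeff f n * I n))) =
      fun n : ℕ ↦ -(((Real.sqrt ((N : ℝ) * n) : ℝ) : ℂ) * KowalskiMichel2000.pet N m (N * n) * I n) := by
    funext n
    rw [KowalskiMichel2000.pet, GL2Family.harmonicSum, finsum_mem_eq_finite_toFinset_sum _ hfin,
      Finset.mul_sum, Finset.sum_mul, ← Finset.sum_neg_distrib]
    refine Finset.sum_congr rfl fun f hf ↦ ?_
    have hf' : IsNewform0 f := hfin.mem_toFinset.mp hf
    have h1 : frickeEigenvalue f * cuspCoeff f n = -cuspCoeff f (N * n) :=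
      Bettin2017.frickeEigenvalue_mul_cuspCoeff hN hf' n
    have h2 : cuspCoeff f (N * n) = ((Real.sqrt ((N : ℝ) * n) : ℝ) : ℂ) * GL2Family.heckeLambda f (N * n) := by
      rw [cuspCoeff_eq_sqrt_mul_heckeLambda, Nat.cast_mul]
    calc (GL2Family.harmonicWeight f : ℂ) * (frickeEigenvalue f * GL2Family.heckeLambda f m * (cuspCoeff f n * I n))
        = (GL2Family.harmonicWeight f : ℂ) * GL2Family.heckeLambda f m *
            (frickeEigenvalue f * cuspCoeff f n) * I n := by ring
      _ = -(((Real.sqrt ((N : ℝ) * n) : ℝ) : ℂ) *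
            ((GL2Family.harmonicWeight f : ℂ) * (GL2Family.heckeLambda f m * GL2Family.heckeLambda f (N * n))) *
              I n) := by rw [h1, h2]; ring
  rw [hfun, hval] at h
  exact h

/-! ## §4. The twisted harmonic first moment at order `k`, unbalanced, at the level of the pair average -/

/-- **Order-`k` twisted harmonic first moment, unbalanced exact formula** (`N` prime, any `m`, `k`, `y > 0`):
`Σʰ_f λ_f(m) Λ^{(k)}(f,½) = 2π q̂^{1/2} [Σ_n √n·pet(m,n)·I_k(n,y) + (−1)^k Σ_n √(Nn)·pet(m,Nn)·I_k(n,1/(Ny))]`,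
`I_k(n,a) = ∫_a^∞ e^{−2πnv}(log √N v)^k dv`, `pet(m,n) = Σʰ λ_f(m)λ_f(n)` (§1 per newform — Fricke eigenvalue
`ε_f = ±1`, `IsNewform0.frickeInvolution_eq_smul_holds` — then §3).
[cite: Bettin2017, §2 (2.1)–(2.3)] [cite: KowalskiMichelVanderKam2000, (13) p. 9] -/
theorem harmonicSum_heckeLambda_mul_derivLambda_eq (hN : N.Prime) (m k : ℕ) {y : ℝ} (hy : 0 < y) :
    GL2Family.harmonicSum N 2 (fun f ↦ GL2Family.heckeLambda f m * derivLambda N k f) =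
      2 * (π : ℂ) * ((qhat N : ℝ) : ℂ) ^ (1 / 2 : ℂ) *
        ((∑' n : ℕ, ((Real.sqrt n : ℝ) : ℂ) * KowalskiMichel2000.pet N m n *
            ((∫ v in Ioi y, Real.exp (-(2 * Real.pi * n) * v) * (Real.log (Real.sqrt N * v)) ^ k : ℝ) : ℂ)) +
          (-1 : ℂ) ^ k * ∑' n : ℕ, ((Real.sqrt ((N : ℝ) * n) : ℝ) : ℂ) * KowalskiMichel2000.pet N m (N * n) *
            ((∫ v in Ioi (((N : ℝ) * y)⁻¹), Real.exp (-(2 * Real.pi * n) * v) *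
              (Real.log (Real.sqrt N * v)) ^ k : ℝ) : ℂ)) := by
  have hfin := finite_newforms0_holds N 2
  have hY : 0 < (((N : ℝ) * y)⁻¹) := inv_pos.mpr (mul_pos (by exact_mod_cast hN.pos) hy)
  set c : ℂ := 2 * (π : ℂ) * ((qhat N : ℝ) : ℂ) ^ (1 / 2 : ℂ) with hc
  set A : CuspForm (Gamma0 N) 2 → ℂ := fun f ↦ ∫ v in Ioi y, f (UpperHalfPlane.ofComplex (Complex.I * v)) *
    (((Real.log (Real.sqrt N * v)) ^ k : ℝ) : ℂ) with hA
  set B : CuspForm (Gamma0 N) 2 → ℂ := fun f ↦ ∫ v in Ioi (((N : ℝ) * y)⁻¹),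
    f (UpperHalfPlane.ofComplex (Complex.I * v)) * (((Real.log (Real.sqrt N * v)) ^ k : ℝ) : ℂ) with hB
  -- per newform
  have hform : ∀ f ∈ newforms0 N 2, GL2Family.heckeLambda f m * derivLambda N k f =
      c * (GL2Family.heckeLambda f m * A f +
        (-1 : ℂ) ^ k * ((-1 : ℂ) * (frickeEigenvalue f * GL2Family.heckeLambda f m * B f))) := by
    intro f hf
    have hfr : frickeInvolution N 2 f = frickeEigenvalue f • f := IsNewform0.frickeInvolution_eq_smul_holds hf
    have hW : IsFrickeEigen N f (frickeEigenvalue f) := isFrickeEigen_of_frickeInvolution_eq_smul N hfr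
    have hε : frickeEigenvalue f ^ 2 = 1 := by
      rcases IsNewform0.frickeEigenvalue_eq_one_or_eq_neg_one_holds (N := N) (k := (2 : ℤ)) hf with h | h <;>
        simp [h]
    rw [derivLambda_eq_unbalanced f k hW hε hy]
    simp only [hc, hA, hB]
    ring
  have hcongr : GL2Family.harmonicSum N 2 (fun f ↦ GL2Family.heckeLambda f m * derivLambda N k f) =
      GL2Family.harmonicSum N 2 (fun f ↦ c * (GL2Family.heckeLambda f m * A f +
        (-1 : ℂ) ^ k * ((-1 : ℂ) * (frickeEigenvalue f * GL2Family.heckeLambda f m * B f)))) := by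
    unfold GL2Family.harmonicSum
    exact finsum_mem_congr rfl fun f hf ↦ by beta_reduce; rw [hform f hf]
  rw [hcongr, GL2Family.harmonicSum_const_mul, GL2Family.harmonicSum_add _ _ hfin, GL2Family.harmonicSum_const_mul,
    GL2Family.harmonicSum_const_mul,
    ← (hasSum_harmonicSum_heckeLambda_mul_axisIntegral (N := N) m k hy).tsum_eq,
    ← (hasSum_harmonicSum_fricke_mul_axisIntegral hN m k hY).tsum_eq, tsum_neg]
  ring

end Summit.Parity.GeneralizedHardyLittlewood.Theorems.MomentsBeyondDiagonal.FirstOrderAFE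

end
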